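import Literature.NumberTheory.EllipticCurves.RootNumberTableThree
import HarnessLib

/-!
# Table II returns a sign on every row support (Rizzo 2003, Table II; §1.2) — proofs

Sibling PROOF file of `Literature.NumberTheory.EllipticCurves.RootNumberTableThree` (the transcription
`Rizzo.tableII` of O. G. Rizzo, *Average root numbers for a nonconstant family of elliptic curves*,
Compositio Math. 136 (2003) 1–23 [Rizzo2003], Table II (p. 4); that file is UNTOUCHED — nothing here
is a definition or a named fact).  Pure bookkeeping on the transcription and integer arithmetic, the
first half of "Table II is complete on elliptic curves over `ℚ`" (the second half, on the invariants
`c₄, c₆, Δ` and `WeierstrassCurve.rootNumberThree`, is `RootNumberTableThreeAdmissibleProofs`):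

* `Rizzo.tableII_w_eq_one_or_eq_neg_one` — if the reduced triple `(a, b, c)` lies in the
  `(a, b, c)`-support of one of the 24 printed rows, then WHATEVER the residues `c₄', c₆', Δ'` the `W₃`
  entry is `+1` or `−1` (never the documented junk value `0`): every printed entry is `±1` or
  "`+1` iff `P`", and the paired special conditions are complementary — rows `(≥2,3,3)`
  (`c₆'² + 2 ≢ / ≡ 3c_{4,2} (9)`) and rows `(≥4,6,9)` / `(4,6,9)` / `(≥5,6,9)`, where for `a ≥ 5` or
  `c₄ = 0` one has `3c_{4,4} = c₄'·3^{a−3} ≡ 0 (9)`, so that "`c₆'² + 2 ≡ 3c_{4,4} (9)`" reads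
  "`c₆' ≡ ±4 (9)`" (`4² ≡ 5² ≡ 7 (9)`) — the one arithmetic remark of the file;
* `Rizzo.tableII_w_eq_one_or_eq_neg_one_of_trichotomy` (`c₄c₆ ≠ 0`), `…_of_c₄_eq_zero` (`a = ⊤`),
  `…_of_c₆_eq_zero` (`b = ⊤`) — the ADMISSIBLE reduced triples lie on the rows: non-negative integers
  `(a, b, c)`, reduced (`a ≤ 3 ∨ b ≤ 5 ∨ c ≤ 11`), subject to the valuation trichotomy that
  `1728Δ = c₄³ − c₆²` forces on `(v₃(c₄), v₃(c₆), v₃(Δ))` — (A) `3a < 2b ∧ c = 3a − 3`, (B) `2b < 3a ∧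
  c = 2b − 3`, (C) `3a = 2b ∧ c ≥ 3a − 3` — are (A) `(1,≥2,0) · (2,≥4,3) · (3,≥5,6) · (4,≥7,9)`,
  (B) `(≥2,2,1) · (≥3,3,3) · (≥3,4,5) · (≥4,5,7) · (≥5,6,9) · (≥5,7,11)` ("`≥`" including `⊤`),
  (C) `(0,0,≥0) · (2,3,≥3) · (4,6,9…11)`, each inside a printed row (`interval_cases` + `omega`).  This is
  [Rizzo2003, §1.2 Remark 4 (p. 6)] "If `p = 3`, we can read the list of admissible values in Table III
  of [Papadopoulos 1993]: in particular, semi-admissibility still implies admissibility" and §1.3 (p. 7)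
  (the tables are proved on "Papadopolous' list of possible triplets"; I. Papadopoulos, J. Number Theory
  44 (1993) 119–152 [Papadopoulos1993], Table III), derived here from `1728Δ = c₄³ − c₆²` alone — so
  slightly more than Papadopoulos' list is covered.

## What is NOT here

Nothing about curves (see `RootNumberTableThreeAdmissibleProofs`); nothing about the VALUES `±1` or the
Kodaira / `v(N)` columns; nothing at `p = 2`.
-/

namespace Literature.NumberTheory.EllipticCurves

namespace Rizzo

/-! ### Bookkeeping on the transcription `Rizzo.tableII` -/

/-- Projection `.2` commutes with `if`. [folklore] -/
private theorem snd_ite {α β : Type*} (P : Prop) [Decidable P] (x y : α × β) :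
    (if P then x else y).2 = if P then x.2 else y.2 := by
  split <;> rfl

/-- One row of the `if`-cascade: a sign on the row, the claim below it. [folklore] -/
private theorem or_ite {P : Prop} [Decidable P] {x y : ℤ} (hx : x = 1 ∨ x = -1)
    (hy : ¬ P → (y = 1 ∨ y = -1)) : (if P then x else y) = 1 ∨ (if P then x else y) = -1 := by
  by_cases hP : P
  · rw [if_pos hP]; exact hx
  · rw [if_neg hP]; exact hy hP

/-- A printed entry "`W₃ = +1` iff `P`" is a sign. [folklore] -/
private theorem sgn_ite (P : Prop) [Decidable P] :
    (if P then (1 : ℤ) else -1) = 1 ∨ (if P then (1 : ℤ) else -1) = -1 := by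
  by_cases hP : P
  · rw [if_pos hP]; exact Or.inl rfl
  · rw [if_neg hP]; exact Or.inr rfl

/-- `atLeast ⊤ k` holds: the printed "`≥ k`" rows admit the valuation `∞` of `0`. [folklore] -/
private theorem atLeast_top (k : ℤ) : KellockDokchitser.atLeast ⊤ k = true := rfl

/-- `atLeast ↑x k` is `k ≤ x`. [folklore] -/
private theorem atLeast_coe (x k : ℤ) :
    KellockDokchitser.atLeast (x : WithTop ℤ) k = decide (k ≤ x) := rfl

/-- For a reduced exponent `a ≥ 5`, or `c₄ = 0`, the quantity `3c_{4,4} = c₄'·3^{a−3}` of the special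
conditions vanishes modulo `9`. [cite: Rizzo2003, p. 2 (notation c_{n,e}) and Table II (p. 4)] -/
private theorem three_mul_c4e_emod_nine {a : WithTop ℤ} (ha : KellockDokchitser.atLeast a 5 = true)
    (x : ℤ) : 3 * c4e a x 4 % 9 = 0 := by
  cases a with
  | top => rfl
  | coe n =>
    rw [atLeast_coe, decide_eq_true_eq] at ha
    obtain ⟨k, hk⟩ : ∃ k : ℕ, (n - 4).toNat = k + 1 := ⟨(n - 4).toNat - 1, by omega⟩
    show 3 * (x * 3 ^ (n - 4).toNat) % 9 = 0
    rw [hk, pow_succ, show 3 * (x * (3 ^ k * 3)) = 9 * (x * 3 ^ k) by ring]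
    exact Int.mul_emod_right 9 _

/-- `c₆'² + 2 ≡ 0 (9)` iff `c₆' ≡ ±4 (9)` (`4² ≡ 5² ≡ 7`; the other squares are `0, 1, 4`). [folklore] -/
private theorem sq_add_two_emod_nine (y : ℤ) : (y ^ 2 + 2) % 9 = 0 ↔ (y % 9 = 4 ∨ y % 9 = 5) := by
  have hr0 : 0 ≤ y % 9 := Int.emod_nonneg y (by norm_num)
  have hr9 : y % 9 < 9 := Int.emod_lt_of_pos y (by norm_num)
  have key : (y ^ 2 + 2) % 9 = ((y % 9) ^ 2 + 2) % 9 := by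
    have hy : y = 9 * (y / 9) + y % 9 := by omega
    generalize y % 9 = r at hy ⊢
    generalize y / 9 = q at hy ⊢
    subst hy
    rw [show (9 * q + r) ^ 2 + 2 = (r ^ 2 + 2) + 9 * (9 * q ^ 2 + 2 * q * r) by ring,
      Int.add_mul_emod_self_left]
  rw [key]
  generalize y % 9 = r at hr0 hr9 ⊢
  interval_cases r <;> decide

/-- On the rows `(≥5, 6, 9)`, and for `c₄ = 0`: "`c₆'² + 2 ≢ 3c_{4,4} (9)`" is "`c₆' ≢ ±4 (9)`", the
complement of the CORRECTED special condition of the row `(≥5, 6, 9)`.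
[cite: Rizzo2003, Table II (p. 4), rows (≥4,6,9) and (≥5,6,9)] -/
private theorem not_res_of_not_sp4 {a : WithTop ℤ} (ha : KellockDokchitser.atLeast a 5 = true)
    {x y : ℤ} (h : ¬ (y ^ 2 + 2) % 9 = 3 * c4e a x 4 % 9) : ¬ (y % 9 = 4 ∨ y % 9 = 5) := by
  rw [three_mul_c4e_emod_nine ha, sq_add_two_emod_nine] at h
  exact h

/-- "`a ≥ 4`" is "`a = 4` or `a ≥ 5`" (row `(≥4,6,9)` versus `(4,6,9)` / `(≥5,6,9)`). [folklore] -/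
private theorem eq_four_or_atLeast_five {a : WithTop ℤ} (ha : KellockDokchitser.atLeast a 4 = true) :
    a = 4 ∨ KellockDokchitser.atLeast a 5 = true := by
  cases a with
  | top => exact Or.inr rfl
  | coe n =>
    rw [atLeast_coe, decide_eq_true_eq] at ha ⊢
    rw [WithTop.coe_eq_ofNat]
    omega

/-- **On its row supports Table II returns a sign, whatever the residues (bookkeeping on the
transcription).**  If the reduced triple `(a, b, c)` (`⊤` = the valuation `∞` of `0`, read "`≥ k`") lies
in the `(a, b, c)`-support of one of the 24 printed rows of `Rizzo.tableII` — listed in the printed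
order, the paired rows `(≥2,3,3)` and `(≥4,6,9)/(4,6,9)/(≥5,6,9)` merged — then for ALL `c₄', c₆', Δ'`
the `W₃` entry is `+1` or `−1`, never the junk value `0`: every printed entry is `±1` or "`+1` iff `P`",
and the paired special conditions are complementary (for `a ≥ 5`: `three_mul_c4e_emod_nine`,
`sq_add_two_emod_nine`).  A 24-step walk down the cascade; at the bottom each support hypothesis meets
the negation of its own row's guard. [cite: Rizzo2003, Table II (p. 4)] -/
theorem tableII_w_eq_one_or_eq_neg_one (a b : WithTop ℤ) (c c4' c6' Δ' : ℤ)
    (h : (a = 0 ∧ b = 0 ∧ c = 0) ∨ (a = 1 ∧ KellockDokchitser.atLeast b 3 = true ∧ c = 0) ∨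
      (a = 0 ∧ b = 0 ∧ 1 ≤ c) ∨ (a = 1 ∧ b = 2 ∧ c = 0) ∨
      (KellockDokchitser.atLeast a 2 = true ∧ b = 2 ∧ c = 1) ∨
      (KellockDokchitser.atLeast a 2 = true ∧ b = 3 ∧ c = 3) ∨ (a = 2 ∧ b = 4 ∧ c = 3) ∨
      (a = 2 ∧ KellockDokchitser.atLeast b 5 = true ∧ c = 3) ∨ (a = 2 ∧ b = 3 ∧ c = 4) ∨
      (a = 2 ∧ b = 3 ∧ c = 5) ∨ (KellockDokchitser.atLeast a 3 = true ∧ b = 4 ∧ c = 5) ∨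
      (a = 2 ∧ b = 3 ∧ 6 ≤ c) ∨ (a = 3 ∧ b = 5 ∧ c = 6) ∨
      (a = 3 ∧ KellockDokchitser.atLeast b 6 = true ∧ c = 6) ∨
      (KellockDokchitser.atLeast a 4 = true ∧ b = 5 ∧ c = 7) ∨
      (KellockDokchitser.atLeast a 4 = true ∧ b = 6 ∧ c = 9) ∨ (a = 4 ∧ b = 7 ∧ c = 9) ∨
      (a = 4 ∧ KellockDokchitser.atLeast b 8 = true ∧ c = 9) ∨ (a = 4 ∧ b = 6 ∧ c = 10) ∨
      (a = 4 ∧ b = 6 ∧ c = 11) ∨ (KellockDokchitser.atLeast a 5 = true ∧ b = 7 ∧ c = 11)) :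
    (tableII a b c c4' c6' Δ').2.2 = 1 ∨ (tableII a b c c4' c6' Δ').2.2 = -1 := by
  unfold tableII
  dsimp only
  simp only [snd_ite]
  refine or_ite (Or.inl rfl) fun g1 => ?_
  refine or_ite (Or.inl rfl) fun g2 => ?_
  refine or_ite (sgn_ite _) fun g3 => ?_
  refine or_ite (Or.inl rfl) fun g4 => ?_
  refine or_ite (sgn_ite _) fun g5 => ?_
  refine or_ite (sgn_ite _) fun g6 => ?_
  refine or_ite (Or.inl rfl) fun g7 => ?_
  refine or_ite (sgn_ite _) fun g8 => ?_
  refine or_ite (Or.inl rfl) fun g9 => ?_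
  refine or_ite (Or.inl rfl) fun g10 => ?_
  refine or_ite (sgn_ite _) fun g11 => ?_
  refine or_ite (sgn_ite _) fun g12 => ?_
  refine or_ite (Or.inr rfl) fun g13 => ?_
  refine or_ite (sgn_ite _) fun g14 => ?_
  refine or_ite (Or.inr rfl) fun g15 => ?_
  refine or_ite (sgn_ite _) fun g16 => ?_
  refine or_ite (Or.inl rfl) fun g17 => ?_
  refine or_ite (sgn_ite _) fun g18 => ?_
  refine or_ite (sgn_ite _) fun g19 => ?_
  refine or_ite (sgn_ite _) fun g20 => ?_
  refine or_ite (Or.inl rfl) fun g21 => ?_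
  refine or_ite (sgn_ite _) fun g22 => ?_
  refine or_ite (sgn_ite _) fun g23 => ?_
  refine or_ite (sgn_ite _) fun g24 => ?_
  exfalso
  rcases h with ⟨ha, hb, hc⟩ | ⟨ha, hb, hc⟩ | ⟨ha, hb, hc⟩ | ⟨ha, hb, hc⟩ | ⟨ha, hb, hc⟩ |
    ⟨ha, hb, hc⟩ | ⟨ha, hb, hc⟩ | ⟨ha, hb, hc⟩ | ⟨ha, hb, hc⟩ | ⟨ha, hb, hc⟩ | ⟨ha, hb, hc⟩ |
    ⟨ha, hb, hc⟩ | ⟨ha, hb, hc⟩ | ⟨ha, hb, hc⟩ | ⟨ha, hb, hc⟩ | ⟨ha, hb, hc⟩ | ⟨ha, hb, hc⟩ |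
    ⟨ha, hb, hc⟩ | ⟨ha, hb, hc⟩ | ⟨ha, hb, hc⟩ | ⟨ha, hb, hc⟩
  · exact g1 ⟨ha, hb, hc⟩
  · exact g2 ⟨ha, hb, hc⟩
  · exact g3 ⟨ha, hb, hc⟩
  · exact g4 ⟨ha, hb, hc⟩
  · exact g5 ⟨ha, hb, hc⟩
  · by_cases hs : (c6' ^ 2 + 2) % 9 = 3 * c4e a c4' 2 % 9
    · exact g7 ⟨ha, hb, hc, decide_eq_true hs⟩
    · exact g6 ⟨ha, hb, hc, decide_eq_false hs⟩
  · exact g8 ⟨ha, hb, hc⟩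
  · exact g9 ⟨ha, hb, hc⟩
  · exact g10 ⟨ha, hb, hc⟩
  · exact g11 ⟨ha, hb, hc⟩
  · exact g12 ⟨ha, hb, hc⟩
  · exact g13 ⟨ha, hb, hc⟩
  · exact g14 ⟨ha, hb, hc⟩
  · exact g15 ⟨ha, hb, hc⟩
  · exact g16 ⟨ha, hb, hc⟩
  · by_cases hs : (c6' ^ 2 + 2) % 9 = 3 * c4e a c4' 4 % 9
    · exact g17 ⟨ha, hb, hc, decide_eq_true hs⟩
    · rcases eq_four_or_atLeast_five ha with ha4 | ha5
      · exact g18 ⟨ha4, hb, hc, decide_eq_false hs⟩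
      · exact g19 ⟨ha5, hb, hc, not_res_of_not_sp4 ha5 hs⟩
  · exact g20 ⟨ha, hb, hc⟩
  · exact g21 ⟨ha, hb, hc⟩
  · exact g22 ⟨ha, hb, hc⟩
  · exact g23 ⟨ha, hb, hc⟩
  · exact g24 ⟨ha, hb, hc⟩

/-! ### The admissible reduced triples (§1.2 / Papadopoulos' list) from `1728Δ = c₄³ − c₆²` alone -/

/-- **Reduced triples with `c₄c₆ ≠ 0` lie on the rows.**  For non-negative integers `(a, b, c)`, reduced
(`a ≤ 3 ∨ b ≤ 5 ∨ c ≤ 11`) and subject to the valuation trichotomy of `1728Δ = c₄³ − c₆²` — `3a < 2b ∧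
c = 3a − 3`, or `2b < 3a ∧ c = 2b − 3`, or `3a = 2b ∧ c ≥ 3a − 3` — Table II gives `W₃ = ±1` for all
residues: the triple is one of `(1,≥2,0) · (2,≥4,3) · (3,≥5,6) · (4,≥7,9)`; `(≥2,2,1) · (≥3,3,3) ·
(≥3,4,5) · (≥4,5,7) · (≥5,6,9) · (≥5,7,11)`; `(0,0,≥0) · (2,3,≥3) · (4,6,9…11)`.
[cite: Rizzo2003, §1.2 Remark 4 (p. 6) and §1.3 (p. 7)] -/
theorem tableII_w_eq_one_or_eq_neg_one_of_trichotomy (a b c c4' c6' Δ' : ℤ) (ha : 0 ≤ a) (hb : 0 ≤ b)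
    (hc : 0 ≤ c) (hred : a ≤ 3 ∨ b ≤ 5 ∨ c ≤ 11)
    (hrel : (3 * a < 2 * b ∧ c = 3 * a - 3) ∨ (2 * b < 3 * a ∧ c = 2 * b - 3) ∨
      (3 * a = 2 * b ∧ 3 * a - 3 ≤ c)) :
    (tableII a b c c4' c6' Δ').2.2 = 1 ∨ (tableII a b c c4' c6' Δ').2.2 = -1 := by
  apply tableII_w_eq_one_or_eq_neg_one
  simp only [atLeast_coe, decide_eq_true_eq, WithTop.coe_eq_zero, WithTop.coe_eq_one,
    WithTop.coe_eq_ofNat]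
  rcases hrel with ⟨h1, rfl⟩ | ⟨h1, rfl⟩ | ⟨h1, h2⟩
  · have ha1 : 1 ≤ a := by omega
    have ha4 : a ≤ 4 := by omega
    interval_cases a
    · rcases (show b = 2 ∨ 3 ≤ b by omega) with rfl | hb3 <;> simp [*]
    · rcases (show b = 4 ∨ 5 ≤ b by omega) with rfl | hb5 <;> simp [*]
    · rcases (show b = 5 ∨ 6 ≤ b by omega) with rfl | hb6 <;> simp [*]
    · rcases (show b = 7 ∨ 8 ≤ b by omega) with rfl | hb8 <;> simp [*]
  · have hb2 : 2 ≤ b := by omega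
    have hb7 : b ≤ 7 := by omega
    interval_cases b
    · simp [show 2 ≤ a by omega]
    · simp [show 2 ≤ a by omega]
    · simp [show 3 ≤ a by omega]
    · simp [show 4 ≤ a by omega]
    · simp [show 4 ≤ a by omega]
    · simp [show 5 ≤ a by omega]
  · have ha5 : a ≤ 5 := by omega
    interval_cases a
    · obtain rfl : b = 0 := by omega
      rcases (show c = 0 ∨ 1 ≤ c by omega) with rfl | hc1 <;> simp [*]
    · omega
    · obtain rfl : b = 3 := by omega
      rcases (show c = 3 ∨ c = 4 ∨ c = 5 ∨ 6 ≤ c by omega) with rfl | rfl | rfl | hc6 <;> simp [*]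
    · omega
    · obtain rfl : b = 6 := by omega
      rcases (show c = 9 ∨ c = 10 ∨ c = 11 by omega) with rfl | rfl | rfl <;> simp
    · omega

/-- **Reduced triples with `c₄ = 0` (`a = ⊤`) lie on the rows**: `−c₆² = 1728Δ` forces `c = 2b − 3`,
and with `b ≤ 5 ∨ c ≤ 11` the triple is one of `(⊤,2,1) · (⊤,3,3) · (⊤,4,5) · (⊤,5,7) · (⊤,6,9) ·
(⊤,7,11)`, all on "`≥`" rows. [cite: Rizzo2003, §1.2 Remark 4 (p. 6) and §1.3 (p. 7)] -/
theorem tableII_w_eq_one_or_eq_neg_one_of_c₄_eq_zero (b c c4' c6' Δ' : ℤ) (hb : 0 ≤ b) (hc : 0 ≤ c)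
    (hred : b ≤ 5 ∨ c ≤ 11) (hrel : c = 2 * b - 3) :
    (tableII ⊤ b c c4' c6' Δ').2.2 = 1 ∨ (tableII ⊤ b c c4' c6' Δ').2.2 = -1 := by
  apply tableII_w_eq_one_or_eq_neg_one
  simp only [atLeast_coe, atLeast_top, decide_eq_true_eq, WithTop.coe_eq_zero, WithTop.coe_eq_ofNat,
    WithTop.top_ne_zero, WithTop.top_ne_one, WithTop.top_ne_ofNat]
  subst hrel
  have hb2 : 2 ≤ b := by omega
  have hb7 : b ≤ 7 := by omega
  interval_cases b <;> simp

/-- **Reduced triples with `c₆ = 0` (`b = ⊤`) lie on the rows**: `c₄³ = 1728Δ` forces `c = 3a − 3`,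
and with `a ≤ 3 ∨ c ≤ 11` the triple is one of `(1,⊤,0) · (2,⊤,3) · (3,⊤,6) · (4,⊤,9)`, all on "`≥`"
rows. [cite: Rizzo2003, §1.2 Remark 4 (p. 6) and §1.3 (p. 7)] -/
theorem tableII_w_eq_one_or_eq_neg_one_of_c₆_eq_zero (a c c4' c6' Δ' : ℤ) (ha : 0 ≤ a) (hc : 0 ≤ c)
    (hred : a ≤ 3 ∨ c ≤ 11) (hrel : c = 3 * a - 3) :
    (tableII a ⊤ c c4' c6' Δ').2.2 = 1 ∨ (tableII a ⊤ c c4' c6' Δ').2.2 = -1 := by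
  apply tableII_w_eq_one_or_eq_neg_one
  simp only [atLeast_coe, atLeast_top, decide_eq_true_eq, WithTop.coe_eq_zero, WithTop.coe_eq_one,
    WithTop.coe_eq_ofNat, WithTop.top_ne_zero, WithTop.top_ne_ofNat]
  subst hrel
  have ha1 : 1 ≤ a := by omega
  have ha4 : a ≤ 4 := by omega
  interval_cases a <;> simp

end Rizzo

end Literature.NumberTheory.EllipticCurves
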